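import Literature.MathematicalPhysics.QuantumFieldTheory.Balaban1983to89.B3Op116CollarHolder
import Literature.MathematicalPhysics.QuantumFieldTheory.Balaban1983to89.B3Op116DKernelRegularTorus

/-!
# `Balaban1983to89.B3Op116CollarRowReduce` — T. Bałaban, *(Higgs)₂,₃ quantum fields in a finite volume. III. Renormalization*,
# Commun. Math. Phys. **88** (1983) 411–445 [Balaban1983Higgs3], (1.16) p. 414 / (2.5)–(2.6) p. 424 / (2.10) p. 426 / p. 433:
# **THE LOCATED LEIBNIZ ROW OF `V_k^Ω(A,B)` ON A `k`-BLOCK UNION, REDUCED TO THE THREE-SLOT ROW OF THE BOX STEP** — support of the chain in `Ω`,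
# the face legs regrouped slice by slice, the two functionals (value at a point of `Ω`, `D^ε_B` at a bond of `Ω`) and their columns
# majorised at every site; F4 (bookkeeping part) of p35 `DESIGN-FILE4.md` §14–§15

statement-level skeleton of published theorems with citation tags; proofs where landed; nothing here is a claim about the Yang–Mills mass gap

PDF held: `paper:balaban1983-higgs-2-3-quantum-fields-finite-volume` (journal page = PDF page + 410; p. 414 = `p0004.txt`, p. 424 = `p0014.txt`,
p. 426 = `p0016.txt`, p. 433 = `p0023.txt`); `paper:balaban1982-cmp85-higgs23-i` (p. 615 = `p0013.txt`).

CITATION HEADER (lean-in-tree rule).  T. Bałaban, CMP **88** (1983) 411–445 [Balaban1983Higgs3]: (1.16) p. 414, (2.5)/(2.6) p. 424, (2.10)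
p. 426, p. 433; part I, CMP **85** (1982) 603–636 [Balaban1982Higgs1]: (3.16) p. 615 (the sources of `V_k(A,B)`), (2.20) p. 610 (`G_k(Ω,·)` on
`φ : Ω → R^N`), (1.7) p. 605.  Cell `lit-balaban` (HOME `run/shared/lean/pub/lit-balaban/`), Phase-2 proof seat **p35** gen 27
(literature-prover-lit-balaban-p35-g27-0; free-target protocol G.5-34(d), TAKING HOME/STATUS.md 2026-08-23T16:58:04Z, cc p40 / r15 / r14 / p33).
SKELETON rows **B3.Eq1.16** / **B3.Eq2.5** / **B3.Txt@433** / **B3.Prop1** (owner r15) — LOCATED SUPPORT FILE of the «(2.5) for (1.16) on a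
cell-product box `□` without the support clause» programme (GAPS.md G-B3-16.A1, route γ′; p35 `DESIGN-FILE4.md` §14 (d)–(e), §15), no head
claim; first of the four F4 files (`B3Op116CollarRowReduce` → `B3Op116StateStepBox` → `B3Op116BoxStateInduction` → `B3Op116DKernelRegularBox`).
USED BY NAME, never restated: p40 g77's located Leibniz row `B3Op116CollarSources.norm_mapE_srcV_collar_leibniz_le` with its bond classes
`inB`/`exB`/`enB` and block-diagonality lemmas (F2, v1.1) and `B3Op116CollarHolder.{sum_le_sum_cover, sum_src_le, sum_tgt_le}`, r14's
`B3Op116SourceForm.{srcV, avgSrc, covDerivAt}`, `B3Op116KernelRegularTorus.norm_mapE_avgSrc_le_block`, `B1Cor23RegularRegion.propagatorK_supported`,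
p35's `B3Op116MajorantStep.maj` and `B3Op116DKernelRegularTorus.kap4`.

WHAT IS PRINTED (verbatim).  p. 414 [PDF 4]: *"for n, n′ sufficiently large, a kernel of the operator (1.16) is a sufficiently regular function of
both variables. More exactly the Hölder norms of the covariant derivatives of this kernel … are exponentially decaying with the distance of the
arguments and are uniformly bounded by O(1)(e(L^kε)^{1−α})^{n+n′} … This estimate follows easily from the properties of the propagators G_k(Ω, A)
proved in the next paper."*  p. 433 [PDF 23]: *"we take a cube □ of size 3r(L^kε) and with □₁ in the center. We assume that □₁, □ are sums of big
blocks of the unit lattice. … We have B̃ = B̃₀ + B̃′, and we expand in B̃′ … we include the operators (1.16) … into the external fields"* — the use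
of the (1.16)/(2.5) bookkeeping on a box with the perturbation supported up to `∂□`.  [B1] p. 615 (3.16): `V_k(A,B)` as the bond terms *"⊂ Ω"* plus
the averaging terms (r14's THEOREM A `B3Op116SourceForm.opV_apply_eq_srcV`).

WHAT THIS FILE PROVES (every `Ω` that is a union of `k`-blocks; `m² > 0`, `a_k ≥ 0`, `k ≤ K`; `sup_b|A_b| ≤ s`, `A` regular with `δ_A`).
* §0 SUPPORT: `V_k^Ω(A,B)w` and `G_k(Ω,X)V_k^Ω(A,B)w` vanish off `Ω` when `w` does (`srcV_apply_eq_zero_of_not_mem`,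
  `propagatorK_srcV_apply_eq_zero_of_not_mem`) — the chain `(1.16)^Ω_{n,n′}ψ` of an `Ω`-supported source stays in `Ω`.
* §1 THE FACE-LEG WEIGHT `κ_F = d·[(ε⁻¹|e|δ_A + ε⁻¹|e|s) + (3ε⁻¹|e|s + 2(|e|s)²)]` (`kapF`) and **`collar_row_reduce`**: p40's located Leibniz
  row of `‖T(V_k^Ω w)‖` (bulk over the charged bonds inside, legs of the bonds crossing `∂Ω`, averaging sources) is BELOW the abstract
  three-slot row of F3 (`B3Op116MajorantStepBox.row_step_box_le`) —
  `Σ_b[κ₁D(b)K(b₊) + (κ₂‖w(b₋)‖ + κ₁D(b))K(b₋) + κ₃‖w(b₊)‖K(b₊)] + κ₄·Σ_zK(z)L^{−kd}Σ_{B^k(z̄)}‖w‖ + κ_F·Σ_iΣ_{y∈F_i}‖w(y)‖K(y)` —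
  for any `D ≥ 0` dominating `‖D^ε_Bw‖` on the charged inside bonds and any finite family of site sets `F_i` covering the initial points of
  `exB` and the final points of `enB` (regrouping: `sum_le_sum_cover`; at most `d` bonds per endpoint: `sum_src_le`/`sum_tgt_le`).
* §2 THE TWO FUNCTIONALS of the step — evaluation at `y ∈ Ω` and `D^ε_B(·)(b₀)` at a bond `b₀ ⊂ Ω`, composed with `G_k(Ω,X)` — kill every
  single-site field off `Ω`, and their column functions are majorised at EVERY site once the box dictionary ((2.10) on `Ω`, exponents 2 / 1)
  holds at the sites of `Ω` (off `Ω` they vanish: block-diagonality, [B1] (2.20)).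
HONEST SCOPE.  Triangle-inequality bookkeeping only (no decay estimate is performed here); the (2.10) dictionary of `G_k(Ω,X)` ON `Ω` and the
regularity of `A` on the whole torus are HYPOTHESES.  Route γ′ is the cell's reading of print's one-piece expansion on `□` (G-B3-16.A1: print does
not spell the face bookkeeping out); nothing of (1.16)/(2.5) is asserted.  One `def` (`kapF`, a displayed constant); no `def … : Prop`, no new named
fact, no `sorry`; axioms standard.  Value = located engine of a by-reference step of B3 — NOT summit progress and nothing about the mass gap.
-/

noncomputable section

open scoped BigOperators

namespace Literature.MathematicalPhysics.QuantumFieldTheory.Balaban1983to89.B3Op116CollarRowReduce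

open HiggsLattice (ChargeData ScalarField covDeriv)
open HiggsCovariance (propagatorK avgQkLin avgQkAdj E)
open HiggsCovariancePos (Inside)
open HiggsAveraging (blockK blockIter mem_blockK)
open B1Eq230FluctCov (Ix cb)
open B3Ineq210MixedRegularTorus (dip)
open B3Op116Pieces (fTwo fTwoAdj fTwo_apply fTwoAdj_apply)
open B3Op116SourceForm (srcV srcMD srcDM srcMM bondSrc avgSrc covDerivAt covDerivAt_apply)
open B3Op116KernelRegularTorus (norm_mapE_avgSrc_le_block)
open B1Cor23RegularRegion (propagatorK_supported)
open B3Op116MajorantStep (maj maj_nonneg)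
open B3Op116CollarSources (inB exB enB mem_inB mem_exB mem_enB norm_mapE_srcV_collar_leibniz_le propagatorK_single_apply_eq_zero_of_not_mem
  propagatorK_cb_apply_eq_zero_of_not_mem covDeriv_eq_zero_of_apply_eq_zero covDeriv_propagatorK_cb_eq_zero_of_not_mem)
open B3Op116CollarHolder (sum_le_sum_cover sum_src_le sum_tgt_le)
open B3Op116DKernelRegularTorus (kap4 kap4_nonneg)

variable {P : HiggsLattice.Params} {N : ℕ}

/-! ## §0 Support: the chain of an `Ω`-supported source stays in `Ω` -/

section Support

variable (C : ChargeData N) (Ω : Finset (HiggsLattice.Site P 0)) (A B : HiggsLattice.VecField P 0) (a : ℝ) {k : ℕ}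
  (hΩ : ∀ x x' : HiggsLattice.Site P 0, blockIter k x = blockIter k x' → (x ∈ Ω ↔ x' ∈ Ω))
include hΩ

/-- **The averaging sources of an `Ω`-supported field vanish off `Ω`** (`Ω` a union of `k`-blocks): `Q_k(B)w`, `F_{2,k}(A,B)w` read `w` only
on the block of the point, which lies off `Ω` with it. [cite: Balaban1982Higgs1, (3.15)–(3.16) pp.614–615, (2.20) p.610] -/
theorem avgSrc_apply_eq_zero_of_not_mem (w : ScalarField P 0 N) (hw : ∀ y : HiggsLattice.Site P 0, y ∉ Ω → w y = 0)
    {x : HiggsLattice.Site P 0} (hx : x ∉ Ω) : avgSrc C A B k w x = 0 := by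
  have hblk : ∀ z ∈ blockK k (blockIter k x), w z = 0 := fun z hz =>
    hw z (fun hzΩ => hx ((hΩ z x ((mem_blockK k _ z).1 hz)).1 hzΩ))
  have hQ : avgQkLin C B k w (blockIter k x) = 0 := by
    rw [HiggsCovariance.avgQkLin_apply, HiggsAveraging.avgQk_apply]
    refine smul_eq_zero_of_right _ (Finset.sum_eq_zero fun z hz => ?_)
    rw [hblk z hz, map_zero]
  have hF : fTwo C A B k w (blockIter k x) = 0 := by
    rw [fTwo_apply]
    refine smul_eq_zero_of_right _ (Finset.sum_eq_zero fun z hz => ?_)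
    simp [hblk z hz]
  have h2 : avgQkAdj C B k (fTwo C A B k w) x = 0 := by
    have h : ‖avgQkAdj C B k (fTwo C A B k w) x‖ = 0 := by
      rw [B3Ineq210RegularTorus.norm_avgQkAdj_apply', hF, norm_zero]
    exact norm_eq_zero.1 h
  rw [avgSrc, Pi.add_apply, Pi.add_apply, h2, fTwoAdj_apply, fTwoAdj_apply, hQ, hF, map_zero, sub_self, map_zero]
  simp

/-- **`V_k^Ω(A,B)w` vanishes off `Ω` when `w` does** (`Ω` a union of `k`-blocks): the bond sources of the bonds `⊂ Ω` sit at their endpoints,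
the averaging sources on the blocks of `Ω`. [cite: Balaban1982Higgs1, (3.16) p.615, (2.20) p.610] [cite: Balaban1983Higgs3, (1.16) p.414] -/
theorem srcV_apply_eq_zero_of_not_mem (w : ScalarField P 0 N) (hw : ∀ y : HiggsLattice.Site P 0, y ∉ Ω → w y = 0)
    {y : HiggsLattice.Site P 0} (hy : y ∉ Ω) : srcV C A B k Ω a w y = 0 := by
  have havg := avgSrc_apply_eq_zero_of_not_mem C Ω A B hΩ w hw hy
  rw [srcV, Pi.sub_apply, Pi.neg_apply, Pi.smul_apply, havg, smul_zero, sub_zero, neg_eq_zero, Finset.sum_apply]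
  refine Finset.sum_eq_zero fun b _ => ?_
  split_ifs with hb
  · have h1 : y ≠ b.tgt := fun h => hy (h ▸ hb.2)
    have h2 : y ≠ b.src := fun h => hy (h ▸ hb.1)
    rw [bondSrc, Pi.add_apply, Pi.add_apply, Pi.smul_apply, srcMD, srcMM, srcDM, dip, Pi.sub_apply, Pi.single_eq_of_ne h1,
      Pi.single_eq_of_ne h1, Pi.single_eq_of_ne h1, Pi.single_eq_of_ne h2, sub_zero, smul_zero, add_zero, add_zero]
  · rfl

/-- **`G_k(Ω,X)V_k^Ω(A,B)w` vanishes off `Ω` when `w` does** (`m² > 0`, `a_k ≥ 0`; block-diagonality `propagatorK_supported`): one insertion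
keeps an `Ω`-supported state `Ω`-supported. [cite: Balaban1982Higgs1, (2.20) p.610, (3.16) p.615] [cite: Balaban1983Higgs3, (1.16) p.414] -/
theorem propagatorK_srcV_apply_eq_zero_of_not_mem (X : HiggsLattice.VecField P 0) {msq : ℝ} (hmsq : 0 < msq) (hak : 0 ≤ B1.aSeq a P.L k)
    (w : ScalarField P 0 N) (hw : ∀ y : HiggsLattice.Site P 0, y ∉ Ω → w y = 0) :
    ∀ y : HiggsLattice.Site P 0, y ∉ Ω → propagatorK C Ω X msq a k (srcV C A B k Ω a w) y = 0 :=
  propagatorK_supported C Ω X hmsq hak hΩ _ fun _ hy => srcV_apply_eq_zero_of_not_mem C Ω A B a hΩ w hw hy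

end Support

/-! ## §1 The face-leg weight and the reduction of the located Leibniz row to F3's three-slot row -/

section Reduce

/-- **The face-leg weight** `κ_F = d·[(ε⁻¹|e|δ_A + ε⁻¹|e|s) + (3ε⁻¹|e|s + 2(|e|s)²)]`: the weights of p40's leaving (`exB`) and entering
(`enB`) legs, times the `d` bonds per endpoint. [cite: Balaban1982Higgs1, (3.16) p.615] [cite: Balaban1983Higgs3, (1.16) p.414, p.433] -/
def kapF (P : HiggsLattice.Params) {N : ℕ} (C : ChargeData N) (s δA : ℝ) : ℝ :=
  (P.d : ℝ) * (((P.mesh 0)⁻¹ * (|C.e| * δA) + (P.mesh 0)⁻¹ * (|C.e| * s)) + (3 * ((P.mesh 0)⁻¹ * (|C.e| * s)) + 2 * (|C.e| * s) ^ 2))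

/-- `κ_F ≥ 0` (`s, δ_A ≥ 0`). [cite: Balaban1983Higgs3, (1.16) p.414] -/
theorem kapF_nonneg {C : ChargeData N} {s δA : ℝ} (hs : 0 ≤ s) (hδA : 0 ≤ δA) : 0 ≤ kapF P C s δA := by
  have := P.mesh_pos 0
  unfold kapF
  positivity

open scoped Classical in
/-- **REDUCTION OF THE LOCATED LEIBNIZ ROW TO THE THREE-SLOT ROW OF F3.**  Any region `Ω`; `sup_b|A_b| ≤ s`, `A` regular with `δ_A`, `k ≤ K`;
`T` a vector-valued linear functional killing every single-site field off `Ω`, `K(z) = Σ_i‖Te_{(z,i)}‖`; `w` vanishing off `Ω`; `D ≥ 0` with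
`‖D^ε_Bw(b)‖ ≤ D(b)` on the charged bonds inside `Ω`; a finite family of site sets `F_i` covering the initial points of `exB` and the final points
of `enB`.  THEN `‖T(V_k^Ω(A,B)w)‖ ≤ Σ_b[κ₁D(b)K(b₊) + (κ₂‖w(b₋)‖ + κ₁D(b))K(b₋) + κ₃‖w(b₊)‖K(b₊)] + κ₄·Σ_zK(z)·L^{−kd}Σ_{u∈B^k(z̄)}‖w(u)‖
+ κ_F·Σ_iΣ_{y∈F_i}‖w(y)‖K(y)` with `κ₁ = |e|s`, `κ₂ = ε⁻¹|e|δ_A`, `κ₃ = (|e|s)²`, `κ₄ = |a_k|(L^kε)^{−2}m(2+m)` (`kap4`), `κ_F = kapF` — p40's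
`norm_mapE_srcV_collar_leibniz_le`, the bulk enlarged from `inB` to all bonds, the averaging sources by block averages
(`norm_mapE_avgSrc_le_block`), the legs regrouped set by set (`sum_le_sum_cover`, `sum_src_le`, `sum_tgt_le`).
[cite: Balaban1982Higgs1, (3.16) p.615] [cite: Balaban1983Higgs3, (1.16) p.414, (2.5) p.424, p.433] -/
theorem collar_row_reduce {M' : Type*} [NormedAddCommGroup M'] [NormedSpace ℝ M']
    (C : ChargeData N) (Ω : Finset (HiggsLattice.Site P 0)) (A B : HiggsLattice.VecField P 0) (a : ℝ) {k : ℕ} (hkK : k ≤ P.K)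
    (T : ScalarField P 0 N →ₗ[ℝ] M') {s δA : ℝ} (hs : 0 ≤ s) (hδA : 0 ≤ δA)
    (hA : ∀ b : HiggsLattice.PBond P 0, |A b| ≤ s)
    (hregA : ∀ (z : HiggsLattice.Site P 0) (μ ν : Fin P.d), |A ⟨z.shift ν, μ⟩ - A ⟨z, μ⟩| ≤ δA)
    (hT : ∀ y : HiggsLattice.Site P 0, y ∉ Ω → ∀ v : E N, T (Pi.single y v) = 0)
    (w : ScalarField P 0 N) (hw : ∀ y : HiggsLattice.Site P 0, y ∉ Ω → w y = 0)
    (Df : HiggsLattice.PBond P 0 → ℝ) (hDf0 : ∀ b, 0 ≤ Df b) (hDf : ∀ b ∈ inB Ω A, ‖covDeriv C B w b‖ ≤ Df b)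
    {nF : ℕ} (F : Fin nF → Finset (HiggsLattice.Site P 0))
    (hexF : ∀ b ∈ exB Ω A, ∃ i : Fin nF, b.src ∈ F i) (henF : ∀ b ∈ enB Ω A, ∃ i : Fin nF, b.tgt ∈ F i) :
    ‖T (srcV C A B k Ω a w)‖
      ≤ (∑ b : HiggsLattice.PBond P 0,
          (|C.e| * s * Df b * (∑ i : Ix N, ‖T (cb P N 0 (b.tgt, i))‖)
            + ((P.mesh 0)⁻¹ * (|C.e| * δA) * ‖w b.src‖ + |C.e| * s * Df b) * (∑ i : Ix N, ‖T (cb P N 0 (b.src, i))‖)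
            + (|C.e| * s) ^ 2 * ‖w b.tgt‖ * (∑ i : Ix N, ‖T (cb P N 0 (b.tgt, i))‖)))
        + kap4 P C k a s * ∑ z : HiggsLattice.Site P 0, (∑ i : Ix N, ‖T (cb P N 0 (z, i))‖) *
            (((P.L : ℝ) ^ (k * P.d))⁻¹ * ∑ u ∈ blockK k (blockIter k z), ‖w u‖)
        + kapF P C s δA * ∑ i : Fin nF, ∑ y ∈ F i, ‖w y‖ * ∑ i' : Ix N, ‖T (cb P N 0 (y, i'))‖ := by
  -- abbreviations
  set K : HiggsLattice.Site P 0 → ℝ := fun z => ∑ i : Ix N, ‖T (cb P N 0 (z, i))‖ with hKdef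
  set m : ℝ := |C.e| * s * P.mesh 0 * (P.d * ((P.L : ℝ) ^ k - 1)) with hm
  set κex : ℝ := (P.mesh 0)⁻¹ * (|C.e| * δA) + (P.mesh 0)⁻¹ * (|C.e| * s) with hκex
  set κen : ℝ := 3 * ((P.mesh 0)⁻¹ * (|C.e| * s)) + 2 * (|C.e| * s) ^ 2 with hκen
  have hε0 : 0 ≤ (P.mesh 0)⁻¹ := inv_nonneg.mpr (P.mesh_pos 0).le
  have hes : 0 ≤ |C.e| * s := mul_nonneg (abs_nonneg _) hs
  have hκ₂0 : 0 ≤ (P.mesh 0)⁻¹ * (|C.e| * δA) := mul_nonneg hε0 (mul_nonneg (abs_nonneg _) hδA)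
  have hκex0 : 0 ≤ κex := add_nonneg hκ₂0 (mul_nonneg hε0 hes)
  have hκen0 : 0 ≤ κen := by rw [hκen]; positivity
  have hd0 : (0 : ℝ) ≤ (P.d : ℝ) := Nat.cast_nonneg _
  have hK0 : ∀ z, 0 ≤ K z := fun z => Finset.sum_nonneg fun _ _ => norm_nonneg _
  have hca : 0 ≤ |B1.aSeq a P.L k| * (P.mesh k)⁻¹ ^ 2 := by positivity
  -- step 1: p40's located Leibniz row
  have hrow := norm_mapE_srcV_collar_leibniz_le C B (Ω := Ω) (A := A) a k T hs hδA hA hregA hT w hw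
  -- step 2: the bulk over `inB` is below the bulk over all bonds with `Df`
  have hbulk : (∑ b ∈ inB Ω A,
        (|C.e| * s * ‖covDeriv C B w b‖ * K b.tgt
          + ((P.mesh 0)⁻¹ * (|C.e| * δA) * ‖w b.src‖ + |C.e| * s * ‖covDeriv C B w b‖) * K b.src
          + (|C.e| * s) ^ 2 * ‖w b.tgt‖ * K b.tgt))
      ≤ ∑ b : HiggsLattice.PBond P 0,
          (|C.e| * s * Df b * K b.tgt + ((P.mesh 0)⁻¹ * (|C.e| * δA) * ‖w b.src‖ + |C.e| * s * Df b) * K b.src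
            + (|C.e| * s) ^ 2 * ‖w b.tgt‖ * K b.tgt) := by
    have hterm : ∀ b ∈ inB Ω A,
        |C.e| * s * ‖covDeriv C B w b‖ * K b.tgt
          + ((P.mesh 0)⁻¹ * (|C.e| * δA) * ‖w b.src‖ + |C.e| * s * ‖covDeriv C B w b‖) * K b.src
          + (|C.e| * s) ^ 2 * ‖w b.tgt‖ * K b.tgt
        ≤ |C.e| * s * Df b * K b.tgt + ((P.mesh 0)⁻¹ * (|C.e| * δA) * ‖w b.src‖ + |C.e| * s * Df b) * K b.src
            + (|C.e| * s) ^ 2 * ‖w b.tgt‖ * K b.tgt := by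
      intro b hb
      have h := hDf b hb
      have h1 : |C.e| * s * ‖covDeriv C B w b‖ * K b.tgt ≤ |C.e| * s * Df b * K b.tgt :=
        mul_le_mul_of_nonneg_right (mul_le_mul_of_nonneg_left h hes) (hK0 _)
      have h2 : |C.e| * s * ‖covDeriv C B w b‖ * K b.src ≤ |C.e| * s * Df b * K b.src :=
        mul_le_mul_of_nonneg_right (mul_le_mul_of_nonneg_left h hes) (hK0 _)
      nlinarith [h1, h2]
    have hnn : ∀ b ∈ (Finset.univ : Finset (HiggsLattice.PBond P 0)), b ∉ inB Ω A →
        0 ≤ |C.e| * s * Df b * K b.tgt + ((P.mesh 0)⁻¹ * (|C.e| * δA) * ‖w b.src‖ + |C.e| * s * Df b) * K b.src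
            + (|C.e| * s) ^ 2 * ‖w b.tgt‖ * K b.tgt := by
      intro b _ _
      have := hDf0 b; have := hK0 b.src; have := hK0 b.tgt; have := norm_nonneg (w b.src); have := norm_nonneg (w b.tgt)
      positivity
    exact (Finset.sum_le_sum hterm).trans (Finset.sum_le_sum_of_subset_of_nonneg (Finset.subset_univ _) hnn)
  -- step 3: the averaging sources by block averages
  have havg : |B1.aSeq a P.L k| * (P.mesh k)⁻¹ ^ 2 * ‖T (avgSrc C A B k w)‖
      ≤ kap4 P C k a s * ∑ z : HiggsLattice.Site P 0, K z * (((P.L : ℝ) ^ (k * P.d))⁻¹ * ∑ u ∈ blockK k (blockIter k z), ‖w u‖) := by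
    have h1 := mul_le_mul_of_nonneg_left (norm_mapE_avgSrc_le_block (C := C) (A := A) (B := B) (k := k) T hkK hs hA w) hca
    refine h1.trans (le_of_eq ?_)
    rw [kap4, Finset.mul_sum, Finset.mul_sum]
    exact Finset.sum_congr rfl fun z _ => by rw [← hm]; ring
  -- step 4: one face set bounds the legs it covers
  have hleg0 : ∀ y, 0 ≤ ‖w y‖ * K y := fun y => mul_nonneg (norm_nonneg _) (hK0 y)
  have hexS : ∑ b ∈ exB Ω A, ‖w b.src‖ * K b.src ≤ (P.d : ℝ) * ∑ i : Fin nF, ∑ y ∈ F i, ‖w y‖ * K y := by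
    have hcov : ∀ b ∈ exB Ω A, ∃ i ∈ (Finset.univ : Finset (Fin nF)), b.src ∈ F i := fun b hb => by
      obtain ⟨i, hi⟩ := hexF b hb; exact ⟨i, Finset.mem_univ _, hi⟩
    refine (sum_le_sum_cover (exB Ω A) Finset.univ (fun i b => (b.src : HiggsLattice.Site P 0) ∈ F i)
      (fun b => ‖w b.src‖ * K b.src) (fun b _ => hleg0 _) hcov).trans ?_
    rw [Finset.mul_sum]
    refine Finset.sum_le_sum fun i _ => ?_
    refine (sum_src_le _ (fun y => ‖w y‖ * K y) hleg0).trans (mul_le_mul_of_nonneg_left ?_ hd0)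
    refine Finset.sum_le_sum_of_subset_of_nonneg (fun y hy => ?_) fun y _ _ => hleg0 y
    obtain ⟨b, hb, rfl⟩ := Finset.mem_image.1 hy
    exact (Finset.mem_filter.1 hb).2
  have henS : ∑ b ∈ enB Ω A, ‖w b.tgt‖ * K b.tgt ≤ (P.d : ℝ) * ∑ i : Fin nF, ∑ y ∈ F i, ‖w y‖ * K y := by
    have hcov : ∀ b ∈ enB Ω A, ∃ i ∈ (Finset.univ : Finset (Fin nF)), b.tgt ∈ F i := fun b hb => by
      obtain ⟨i, hi⟩ := henF b hb; exact ⟨i, Finset.mem_univ _, hi⟩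
    refine (sum_le_sum_cover (enB Ω A) Finset.univ (fun i b => (b.tgt : HiggsLattice.Site P 0) ∈ F i)
      (fun b => ‖w b.tgt‖ * K b.tgt) (fun b _ => hleg0 _) hcov).trans ?_
    rw [Finset.mul_sum]
    refine Finset.sum_le_sum fun i _ => ?_
    refine (sum_tgt_le _ (fun y => ‖w y‖ * K y) hleg0).trans (mul_le_mul_of_nonneg_left ?_ hd0)
    refine Finset.sum_le_sum_of_subset_of_nonneg (fun y hy => ?_) fun y _ _ => hleg0 y
    obtain ⟨b, hb, rfl⟩ := Finset.mem_image.1 hy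
    exact (Finset.mem_filter.1 hb).2
  have hfaces : (∑ b ∈ exB Ω A, κex * ‖w b.src‖ * K b.src) + (∑ b ∈ enB Ω A, κen * ‖w b.tgt‖ * K b.tgt)
      ≤ kapF P C s δA * ∑ i : Fin nF, ∑ y ∈ F i, ‖w y‖ * K y := by
    have e1 : ∑ b ∈ exB Ω A, κex * ‖w b.src‖ * K b.src = κex * ∑ b ∈ exB Ω A, ‖w b.src‖ * K b.src := by
      rw [Finset.mul_sum]; exact Finset.sum_congr rfl fun b _ => by ring
    have e2 : ∑ b ∈ enB Ω A, κen * ‖w b.tgt‖ * K b.tgt = κen * ∑ b ∈ enB Ω A, ‖w b.tgt‖ * K b.tgt := by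
      rw [Finset.mul_sum]; exact Finset.sum_congr rfl fun b _ => by ring
    rw [e1, e2]
    have h1 := mul_le_mul_of_nonneg_left hexS hκex0
    have h2 := mul_le_mul_of_nonneg_left henS hκen0
    have e3 : κex * ((P.d : ℝ) * ∑ i : Fin nF, ∑ y ∈ F i, ‖w y‖ * K y) + κen * ((P.d : ℝ) * ∑ i : Fin nF, ∑ y ∈ F i, ‖w y‖ * K y)
        = kapF P C s δA * ∑ i : Fin nF, ∑ y ∈ F i, ‖w y‖ * K y := by
      rw [kapF, hκex, hκen]; ring
    linarith [h1, h2, e3]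
  -- assemble
  linarith [hrow, hbulk, havg, hfaces]

end Reduce

/-! ## §2 The two functionals of the step: they kill single-site fields off `Ω`; their columns are majorised everywhere -/

section Functionals

variable (C : ChargeData N) (Ω : Finset (HiggsLattice.Site P 0)) (X : HiggsLattice.VecField P 0) {msq : ℝ} (a : ℝ) {k : ℕ}
  (hmsq : 0 < msq) (hak : 0 ≤ B1.aSeq a P.L k)
  (hΩ : ∀ x x' : HiggsLattice.Site P 0, blockIter k x = blockIter k x' → (x ∈ Ω ↔ x' ∈ Ω))
include hmsq hak hΩ

/-- The value functional `φ ↦ (G_k(Ω,X)φ)(y)` at `y ∈ Ω` kills every single-site field off `Ω`. [cite: Balaban1982Higgs1, (2.20) p.610] -/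
theorem proj_propagatorK_single_eq_zero {y : HiggsLattice.Site P 0} (hy : y ∈ Ω) {z : HiggsLattice.Site P 0} (hz : z ∉ Ω) (v : E N) :
    ((LinearMap.proj y : ScalarField P 0 N →ₗ[ℝ] E N) ∘ₗ (propagatorK C Ω X msq a k : ScalarField P 0 N →ₗ[ℝ] ScalarField P 0 N))
      (Pi.single z v) = 0 :=
  propagatorK_single_apply_eq_zero_of_not_mem C Ω X a hmsq hak hΩ hz hy v

/-- The derivative functional `φ ↦ (D^ε_BG_k(Ω,X)φ)(b₀)` at a bond `b₀ ⊂ Ω` kills every single-site field off `Ω`.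
[cite: Balaban1982Higgs1, (1.7) p.605, (2.20) p.610] -/
theorem covDerivAt_propagatorK_single_eq_zero (B : HiggsLattice.VecField P 0) {b₀ : HiggsLattice.PBond P 0} (hb₀ : Inside Ω b₀)
    {z : HiggsLattice.Site P 0} (hz : z ∉ Ω) (v : E N) :
    (covDerivAt C B b₀ ∘ₗ (propagatorK C Ω X msq a k : ScalarField P 0 N →ₗ[ℝ] ScalarField P 0 N)) (Pi.single z v) = 0 := by
  rw [LinearMap.coe_comp, Function.comp_apply, covDerivAt_apply]
  exact covDeriv_eq_zero_of_apply_eq_zero C B _ (propagatorK_single_apply_eq_zero_of_not_mem C Ω X a hmsq hak hΩ hz hb₀.1 v)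
    (propagatorK_single_apply_eq_zero_of_not_mem C Ω X a hmsq hak hΩ hz hb₀.2 v)

/-- **The value column is majorised at every site** once the dictionary holds on `Ω` (off `Ω` it vanishes): for `y ∈ Ω` and all `z`,
`Σ_i‖(G_k(Ω,X)e_{(z,i)})(y)‖ ≤ 𝔪_k(c_{K2},2;δ₁)(y,z)`. [cite: Balaban1983Higgs3, (2.6) p.424, (2.10) p.426] [cite: Balaban1982Higgs1, (2.20) p.610] -/
theorem col_le_maj_all {cK2 δ₁ : ℝ} (hcK2 : 0 ≤ cK2)
    (hcol : ∀ x ∈ Ω, ∀ z ∈ Ω, ∑ i : Ix N, ‖propagatorK C Ω X msq a k (cb P N 0 (z, i)) x‖ ≤ maj P k cK2 2 δ₁ x z)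
    {y : HiggsLattice.Site P 0} (hy : y ∈ Ω) (z : HiggsLattice.Site P 0) :
    ∑ i : Ix N, ‖propagatorK C Ω X msq a k (cb P N 0 (z, i)) y‖ ≤ maj P k cK2 2 δ₁ y z := by
  by_cases hz : z ∈ Ω
  · exact hcol y hy z hz
  · rw [Finset.sum_eq_zero (fun i _ => by rw [propagatorK_cb_apply_eq_zero_of_not_mem C Ω X a hmsq hak hΩ hz hy i, norm_zero])]
    exact maj_nonneg hcK2 y z

/-- **The differentiated column is majorised at every site** once the dictionary holds on `Ω`: for `b₀ ⊂ Ω` and all `z`,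
`Σ_i‖(D^ε_BG_k(Ω,X)e_{(z,i)})(b₀)‖ ≤ 𝔪_k(c_{K1},1;δ₁)(b₀₋,z)`. [cite: Balaban1983Higgs3, (2.6) p.424, (2.10) p.426] [cite: Balaban1982Higgs1, (2.20) p.610] -/
theorem dcol_le_maj_all (B : HiggsLattice.VecField P 0) {cK1 δ₁ : ℝ} (hcK1 : 0 ≤ cK1)
    (hdcol : ∀ b : HiggsLattice.PBond P 0, Inside Ω b → ∀ z ∈ Ω,
      ∑ i : Ix N, ‖covDeriv C B (propagatorK C Ω X msq a k (cb P N 0 (z, i))) b‖ ≤ maj P k cK1 1 δ₁ b.src z)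
    {b₀ : HiggsLattice.PBond P 0} (hb₀ : Inside Ω b₀) (z : HiggsLattice.Site P 0) :
    ∑ i : Ix N, ‖covDeriv C B (propagatorK C Ω X msq a k (cb P N 0 (z, i))) b₀‖ ≤ maj P k cK1 1 δ₁ b₀.src z := by
  by_cases hz : z ∈ Ω
  · exact hdcol b₀ hb₀ z hz
  · rw [Finset.sum_eq_zero (fun i _ => by
      rw [covDeriv_propagatorK_cb_eq_zero_of_not_mem C Ω X a hmsq hak hΩ B hz hb₀ i, norm_zero])]
    exact maj_nonneg hcK1 _ z

end Functionals

end Literature.MathematicalPhysics.QuantumFieldTheory.Balaban1983to89.B3Op116CollarRowReduce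

end
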